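import Literature.MathematicalPhysics.QuantumFieldTheory.VillainEnsembleProjection
import Literature.MathematicalPhysics.QuantumFieldTheory.VillainLocalPrimitive
import Literature.Probability.LatticeModels.EnsembleGeometry
import Literature.Probability.LatticeModels.EnsemblePhaseSummation
import HarnessLib

/-!
# The phase loss of a 1-ensemble of the Villain monopole gas against the Coulomb field of the
# loop (Fröhlich–Spencer §2.10, (2.81)–(2.87))

Support file for the Coulomb-gas (monopole) representation of four-dimensional `U(1)` lattice gauge
theory with the Villain action (proof programme of the named fact
`Literature.MathematicalPhysics.QuantumFieldTheory.FrohlichSpencerU1PerimeterLawD4` and of its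
corollary `Literature.Barriers.QuantumFields.AbelianDeconfinementD4`). After renormalisation
(`VillainRenormalisation`) one term of the closed-ensemble expansion of the Wilson numerator is
`∫ e^{-½aᵀPa} ∏_ρ (1 + z̄_ρ cos(ā_ρ(a) + ρ(ψ))) da` with the shift `ψ = 2π B'⁻¹ D S` of the sheet
`S` of the loop. This file rewrites the phases `ρ(ψ)` modulo `2π` and bounds the resulting loss
`∑_ρ γ(z̄_ρ) θ_ρ²` of Jensen's inequality (FS82 (2.80)) by `c_J ‖ε‖² + C₀`, `ε` the exact
(spin-wave) part of `S` — FS82 (2.81)–(2.87), p. 432, with the constants uniform in the box: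

* `lowPt/highPt` (bounding box of a density), `width_le_card` (connected supports are as wide as
  they are long), `Small` (never meets two opposite faces of the box);
* `exists_theta`/`theta` (**FS82 (2.56)–(2.57)**): for a closed small density
  `ρ = d m_ρ` with the local integer primitive of `VillainLocalPrimitive`,
  `cos(X + ρ(ψ)) = cos(X - θ_ρ)` with `θ_ρ = 2π(ε, m_ρ)`, `|θ_ρ| ≤ 32π ‖ρ‖₁ ∑_{p ∈ H_ρ} |ε_p|`
  (periodicity of the cosine: `(S, m_ρ) ∈ ℤ`); otherwise `|θ_ρ| ≤ π`;
* counting: `card_filter_mem_hull_le` (densities of size `s` whose hull contains a plaquette),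
  `card_le_of_oneEnsemble`, `card_CIdx_le`;
* **`sum_gamma_theta_sq_le`**: for a 1-ensemble of connected densities with weights
  `0 ≤ γ_ρ ≤ 7 e^{-10 ∑_c ρ_c²}` vanishing on non-closed densities,
  `∑_ρ γ_ρ θ_ρ² ≤ cJ (ε ⬝ ε) + C0`.

Everything is proved; no named fact is introduced.

## References

* J. Fröhlich, T. Spencer, Comm. Math. Phys. 83 (1982) 411–454, §2.7 (2.56)–(2.57), §2.10
  (2.81)–(2.87), p. 432. [FrohlichSpencerCMP1982]
-/

noncomputable section

open Finset Function Matrix MeasureTheory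
open scoped Real
open Literature.Probability.LatticeModels
open Literature.Probability.LatticeModels.GaussianCoord (exactPart perpPart lap)
open Literature.Probability.LatticeModels.EnsembleExpansion (phase IsOneEnsemble IsAdjConnected
  sum_mul_sq_le_of_count card_filter_subset_le mem_Icc_site_of_forall_abs_le)

namespace Literature.MathematicalPhysics.QuantumFieldTheory

/-- Sites of `ℤ^d` (the namespace-local `Site` is the torus one). -/
local notation "ZSite" => Literature.Probability.LatticeModels.Site

namespace VillainAngle

open AxialGauge LatticeForm LatticeChain VillainFibre

variable {n : ℕ}

/-! ### The bounding box of a density -/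

/-- The lowest base-point coordinates of the support (`0` for the zero density). [folklore] -/
def lowPt (ρ : CIdx 4 n →₀ ℤ) : ZSite 4 := fun a =>
  if h : ρ.support.Nonempty then (ρ.support.image fun c => c.1.1 a).min' (h.image _) else 0

/-- The highest base-point coordinates of the support (`0` for the zero density). [folklore] -/
def highPt (ρ : CIdx 4 n →₀ ℤ) : ZSite 4 := fun a =>
  if h : ρ.support.Nonempty then (ρ.support.image fun c => c.1.1 a).max' (h.image _) else 0

/-- Support points lie above `lowPt`. [folklore] -/
theorem lowPt_le {ρ : CIdx 4 n →₀ ℤ} {c : CIdx 4 n} (hc : c ∈ ρ.support) : lowPt ρ ≤ c.1.1 := by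
  intro a
  have h : ρ.support.Nonempty := ⟨c, hc⟩
  simp only [lowPt, dif_pos h]
  exact Finset.min'_le _ _ (Finset.mem_image_of_mem (fun c : CIdx 4 n => c.1.1 a) hc)

/-- Support points lie below `highPt`. [folklore] -/
theorem le_highPt {ρ : CIdx 4 n →₀ ℤ} {c : CIdx 4 n} (hc : c ∈ ρ.support) : c.1.1 ≤ highPt ρ := by
  intro a
  have h : ρ.support.Nonempty := ⟨c, hc⟩
  simp only [highPt, dif_pos h]
  exact Finset.le_max' _ _ (Finset.mem_image_of_mem (fun c : CIdx 4 n => c.1.1 a) hc)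

/-- `lowPt` is attained. [folklore] -/
theorem exists_apply_eq_lowPt {ρ : CIdx 4 n →₀ ℤ} (h : ρ.support.Nonempty) (a : Fin 4) :
    ∃ c ∈ ρ.support, c.1.1 a = lowPt ρ a := by
  simp only [lowPt, dif_pos h]
  obtain ⟨c, hc, hca⟩ := Finset.mem_image.1 (Finset.min'_mem (ρ.support.image fun c => c.1.1 a) (h.image _))
  exact ⟨c, hc, hca⟩

/-- `highPt` is attained. [folklore] -/
theorem exists_apply_eq_highPt {ρ : CIdx 4 n →₀ ℤ} (h : ρ.support.Nonempty) (a : Fin 4) :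
    ∃ c ∈ ρ.support, c.1.1 a = highPt ρ a := by
  simp only [highPt, dif_pos h]
  obtain ⟨c, hc, hca⟩ := Finset.mem_image.1 (Finset.max'_mem (ρ.support.image fun c => c.1.1 a) (h.image _))
  exact ⟨c, hc, hca⟩

/-- `lowPt ≤ highPt`. [folklore] -/
theorem lowPt_le_highPt (ρ : CIdx 4 n →₀ ℤ) : lowPt ρ ≤ highPt ρ := by
  intro a
  by_cases h : ρ.support.Nonempty
  · obtain ⟨c, hc, -⟩ := exists_apply_eq_lowPt h a
    exact (lowPt_le hc a).trans (le_highPt hc a)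
  · simp [lowPt, highPt, h]

/-- **Connected supports are as wide as they are long**: `highPt a - lowPt a ≤ #supp ρ - 1`
(FS82 (2.85): the hypercube of a density of a 1-ensemble has side `≤ L(ρ)`). [cite: FrohlichSpencerCMP1982, §2.10 (2.85)] -/
theorem width_le_card {ρ : CIdx 4 n →₀ ℤ} (hconn : IsAdjConnected adjC ρ.support) (h : ρ.support.Nonempty)
    (a : Fin 4) : highPt ρ a - lowPt ρ a ≤ (ρ.support.card : ℤ) - 1 := by
  obtain ⟨c, hc, hca⟩ := exists_apply_eq_lowPt h a
  obtain ⟨c', hc', hca'⟩ := exists_apply_eq_highPt h a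
  have key := hconn.dist_le (fun x y : CIdx 4 n => (x.1.1 a - y.1.1 a).natAbs) (fun x => by simp)
    (fun x y w => by omega) (fun x y => by omega) 1
    (fun x y hxy => by have := hxy.2 a; rw [abs_le] at this; omega) hc' hc
  have hcard : 1 ≤ ρ.support.card := Finset.card_pos.2 h
  have : ((c'.1.1 a - c.1.1 a).natAbs : ℤ) ≤ (ρ.support.card : ℤ) - 1 := by
    have := Int.ofNat_le.2 key
    push_cast [Nat.cast_sub hcard] at this
    simpa using this
  rw [← hca, ← hca']
  omega

/-- **Small densities**: the bounding box is narrower than the box in every direction, so that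
the support never meets two opposite faces. [folklore] -/
def Small (ρ : CIdx 4 n →₀ ℤ) : Prop := ∀ a : Fin 4, highPt ρ a - lowPt ρ a + 1 < n

/-- Large densities are long: `n ≤ #supp ρ`. [folklore] -/
theorem le_card_of_not_small {ρ : CIdx 4 n →₀ ℤ} (hconn : IsAdjConnected adjC ρ.support)
    (hne : ρ.support.Nonempty) (h : ¬Small ρ) : (n : ℤ) ≤ ρ.support.card := by
  simp only [Small, not_forall, not_lt] at h
  obtain ⟨a, ha⟩ := h
  have := width_le_card hconn hne a
  omega

/-! ### The hull of a density and its phase representative -/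

open Classical in
/-- **The hull** `H_ρ`: the plaquettes of the box within the `2`-neighbourhood of the bounding box
of `ρ` (it carries the local primitive `m_ρ`; FS82's hypercube `Ω_ρ`). [cite: FrohlichSpencerCMP1982, §2.10 (2.82), (2.85)] -/
def hull (ρ : CIdx 4 n →₀ ℤ) : Finset (PIdx 4 n) :=
  Finset.univ.filter fun p => lowPt ρ - 2 ≤ p.1.1 ∧ p.1.1 ≤ highPt ρ + 1

open Classical in
/-- Membership in the hull. [folklore] -/
theorem mem_hull {ρ : CIdx 4 n →₀ ℤ} {p : PIdx 4 n} : p ∈ hull ρ ↔ lowPt ρ - 2 ≤ p.1.1 ∧ p.1.1 ≤ highPt ρ + 1 := by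
  simp [hull]

/-- The `ℓ¹` norm of a density. [folklore] -/
def l1 (ρ : CIdx 4 n →₀ ℤ) : ℝ := ∑ c, |(ρ c : ℝ)|

/-- `‖ρ‖₁ ≥ 0`. [folklore] -/
theorem l1_nonneg (ρ : CIdx 4 n →₀ ℤ) : 0 ≤ l1 ρ := Finset.sum_nonneg fun _ _ => abs_nonneg _

/-- The squared `ℓ²` norm of a density. [folklore] -/
def wt (ρ : CIdx 4 n →₀ ℤ) : ℝ := ∑ c ∈ ρ.support, ((ρ c : ℝ)) ^ 2

/-- `‖ρ‖₁ ≤ ‖ρ‖₂²` for integer densities. [folklore] -/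
theorem l1_le_wt (ρ : CIdx 4 n →₀ ℤ) : l1 ρ ≤ wt ρ := by
  classical
  rw [l1, wt, ← Finset.sum_subset (Finset.subset_univ ρ.support) (fun c _ hc => by
    rw [Finsupp.notMem_support_iff.1 hc]; simp)]
  refine Finset.sum_le_sum fun c _ => ?_
  rcases eq_or_ne (ρ c) 0 with h | h
  · simp [h]
  · have h1 : (1 : ℝ) ≤ |(ρ c : ℝ)| := by
      rw [← Int.cast_abs]; exact_mod_cast Int.one_le_abs h
    nlinarith [abs_nonneg ((ρ c : ℝ)), sq_abs ((ρ c : ℝ))]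

/-- `#supp ρ ≤ ‖ρ‖₂²` for integer densities. [folklore] -/
theorem card_le_wt (ρ : CIdx 4 n →₀ ℤ) : (ρ.support.card : ℝ) ≤ wt ρ := by
  rw [wt, Finset.card_eq_sum_ones, Nat.cast_sum]
  refine Finset.sum_le_sum fun c hc => ?_
  have h : (ρ c : ℝ) ≠ 0 := by exact_mod_cast Finsupp.mem_support_iff.1 hc
  have h1 : (1 : ℝ) ≤ |(ρ c : ℝ)| := by
    rw [← Int.cast_abs]; exact_mod_cast Int.one_le_abs (Finsupp.mem_support_iff.1 hc)
  calc ((1 : ℕ) : ℝ) = 1 := Nat.cast_one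
    _ ≤ |(ρ c : ℝ)| ^ 2 := by nlinarith
    _ = ((ρ c : ℝ)) ^ 2 := sq_abs _

/-- The exact (spin-wave) part of the sheet. [cite: FrohlichSpencerCMP1982, §2.7 (2.51)] -/
def epsField (S : PIdx 4 n → ℤ) : PIdx 4 n → ℝ := exactPart dMat fun p => (S p : ℝ)

/-- **The phase of a flux against the shift is the pairing of a primitive with the orthogonal part
of the sheet** (FS82 (2.52)–(2.54)): `ρ(ψ) = 2π (S - ε, m)` for `ρ = dm`. [cite: FrohlichSpencerCMP1982, §2.7 (2.52)–(2.54)] -/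
theorem phase_auxShift_eq (S : PIdx 4 n → ℤ) (m : PIdx 4 n → ℤ) (ρ : CIdx 4 n →₀ ℤ)
    (hρ : fluxMap m = ⇑ρ) :
    phase ρ (auxShift fun p => (S p : ℝ)) =
      2 * π * ((fun p => (S p : ℝ)) ⬝ᵥ (fun p => (m p : ℝ)) - epsField S ⬝ᵥ fun p => (m p : ℝ)) := by
  rw [phase_eq_dotProduct, auxShift, dotProduct_smul, smul_eq_mul]
  congr 1
  have hcast : (fun c => (ρ c : ℝ)) = DMat *ᵥ fun p => (m p : ℝ) := by
    rw [DMat_mulVec, fluxMapA_intCast, hρ]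
  rw [hcast, lapV, flux_dotProduct_inv_lap, perpPart, sub_dotProduct, epsField]

/-- The pairing of two integer fields is an integer. [folklore] -/
theorem exists_int_dotProduct (S m : PIdx 4 n → ℤ) :
    ∃ k : ℤ, (fun p => (S p : ℝ)) ⬝ᵥ (fun p => (m p : ℝ)) = k := by
  refine ⟨∑ p, S p * m p, ?_⟩
  simp [dotProduct]

/-- **The phase representatives** (FS82 (2.56)–(2.57), by the periodicity of the cosine): for every
density there is `θ_ρ` with `cos(X + ρ(ψ)) = cos(X - θ_ρ)`, equal to `2π(ε, m_ρ)` for the local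
integer primitive `m_ρ` when `ρ` is closed, small and non-zero, and in `[-π, π]` otherwise.
[cite: FrohlichSpencerCMP1982, §2.7 (2.56)–(2.57)] -/
theorem exists_theta (hn : 1 ≤ n) (S : PIdx 4 n → ℤ) (ρ : CIdx 4 n →₀ ℤ) :
    ∃ θρ : ℝ, (∀ X, Real.cos (X + phase ρ (auxShift fun p => (S p : ℝ))) = Real.cos (X - θρ)) ∧
      ((IsClosedFlux (⇑ρ) ∧ Small ρ ∧ ρ ≠ 0) →
        |θρ| ≤ 32 * π * l1 ρ * ∑ p ∈ hull ρ, |epsField S p|) ∧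
      (¬(IsClosedFlux (⇑ρ) ∧ Small ρ ∧ ρ ≠ 0) → |θρ| ≤ π) := by
  classical
  by_cases hcs : IsClosedFlux (⇑ρ) ∧ Small ρ ∧ ρ ≠ 0
  · obtain ⟨hcl, hsm, hne⟩ := hcs
    obtain ⟨m, hm, hsupp, hle⟩ := exists_local_intPrimitive hn (⇑ρ) hcl (lowPt ρ) (highPt ρ)
      (fun c hc => ⟨lowPt_le (Finsupp.mem_support_iff.2 hc), le_highPt (Finsupp.mem_support_iff.2 hc)⟩) hsm
    obtain ⟨k, hk⟩ := exists_int_dotProduct S m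
    refine ⟨2 * π * (epsField S ⬝ᵥ fun p => (m p : ℝ)), fun X => ?_, fun _ => ?_, fun h => absurd ⟨hcl, hsm, hne⟩ h⟩
    · rw [phase_auxShift_eq S m ρ hm, hk,
        show X + 2 * π * ((k : ℝ) - epsField S ⬝ᵥ fun p => (m p : ℝ)) =
          (X - 2 * π * (epsField S ⬝ᵥ fun p => (m p : ℝ))) + k * (2 * π) by ring,
        Real.cos_add_int_mul_two_pi]
    · -- `|2π(ε, m)| ≤ 2π · 16‖ρ‖₁ · ∑_{H} |ε|`
      rw [abs_mul, abs_of_pos (by positivity : (0 : ℝ) < 2 * π)]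
      have hdot : |epsField S ⬝ᵥ fun p => (m p : ℝ)| ≤ 16 * l1 ρ * ∑ p ∈ hull ρ, |epsField S p| := by
        calc |epsField S ⬝ᵥ fun p => (m p : ℝ)| ≤ ∑ p, |epsField S p * (m p : ℝ)| := Finset.abs_sum_le_sum_abs _ _
          _ = ∑ p ∈ hull ρ, |epsField S p| * |(m p : ℝ)| := by
              rw [← Finset.sum_subset (Finset.subset_univ (hull ρ))]
              · exact Finset.sum_congr rfl fun p _ => abs_mul _ _
              · intro p _ hp
                have : m p = 0 := by
                  by_contra hmp
                  exact hp (mem_hull.2 (hsupp p hmp))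
                simp [this]
          _ ≤ ∑ p ∈ hull ρ, |epsField S p| * (16 * l1 ρ) := by
              refine Finset.sum_le_sum fun p _ => mul_le_mul_of_nonneg_left ?_ (abs_nonneg _)
              have := hle p
              rw [← Int.cast_abs]
              calc ((|m p| : ℤ) : ℝ) ≤ ((16 * ∑ c, |ρ c| : ℤ) : ℝ) := by exact_mod_cast this
                _ = 16 * l1 ρ := by simp [l1]
          _ = 16 * l1 ρ * ∑ p ∈ hull ρ, |epsField S p| := by rw [← Finset.sum_mul]; ring
      calc 2 * π * |epsField S ⬝ᵥ fun p => (m p : ℝ)| ≤ 2 * π * (16 * l1 ρ * ∑ p ∈ hull ρ, |epsField S p|) :=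
            mul_le_mul_of_nonneg_left hdot (by positivity)
        _ = 32 * π * l1 ρ * ∑ p ∈ hull ρ, |epsField S p| := by ring
  · -- crude representative in `[-π, π]`
    set φ := phase ρ (auxShift fun p => (S p : ℝ)) with hφ
    refine ⟨-toIocMod Real.two_pi_pos (-π) φ, fun X => ?_, fun h => absurd h hcs, fun _ => ?_⟩
    · rw [sub_neg_eq_add]
      obtain ⟨k, hk⟩ : ∃ k : ℤ, toIocMod Real.two_pi_pos (-π) φ = φ + k * (2 * π) := by
        refine ⟨-toIocDiv Real.two_pi_pos (-π) φ, ?_⟩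
        rw [toIocMod, zsmul_eq_mul]; push_cast; ring
      rw [hk, ← add_assoc, Real.cos_add_int_mul_two_pi]
    · rw [abs_neg, abs_le]
      have h1 := left_lt_toIocMod Real.two_pi_pos (-π) φ
      have h2 := toIocMod_le_right Real.two_pi_pos (-π) φ
      constructor <;> linarith

/-- **The phase representative** of a density (a choice). [cite: FrohlichSpencerCMP1982, §2.7 (2.56)–(2.57)] -/
def theta (hn : 1 ≤ n) (S : PIdx 4 n → ℤ) (ρ : CIdx 4 n →₀ ℤ) : ℝ := (exists_theta hn S ρ).choose

/-- The defining properties of `theta`. [folklore] -/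
theorem theta_spec (hn : 1 ≤ n) (S : PIdx 4 n → ℤ) (ρ : CIdx 4 n →₀ ℤ) :
    (∀ X, Real.cos (X + phase ρ (auxShift fun p => (S p : ℝ))) = Real.cos (X - theta hn S ρ)) ∧
      ((IsClosedFlux (⇑ρ) ∧ Small ρ ∧ ρ ≠ 0) →
        |theta hn S ρ| ≤ 32 * π * l1 ρ * ∑ p ∈ hull ρ, |epsField S p|) ∧
      (¬(IsClosedFlux (⇑ρ) ∧ Small ρ ∧ ρ ≠ 0) → |theta hn S ρ| ≤ π) :=
  (exists_theta hn S ρ).choose_spec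

/-- `|θ_ρ| ≤ π ∨ local bound`; in all cases `|θ_ρ| ≤ max`. [folklore] -/
theorem cos_add_phase_eq (hn : 1 ≤ n) (S : PIdx 4 n → ℤ) (ρ : CIdx 4 n →₀ ℤ) (X : ℝ) :
    Real.cos (X + phase ρ (auxShift fun p => (S p : ℝ))) = Real.cos (X - theta hn S ρ) :=
  (theta_spec hn S ρ).1 X

/-! ### Counting densities -/

/-- `#CIdx ≤ 64 n⁴`. [folklore] -/
theorem card_CIdx_le : Fintype.card (CIdx 4 n) ≤ 64 * n ^ 4 := by
  classical
  rw [Fintype.card_coe]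
  calc (cubesIn (halfOpenBox 4 n)).card
      ≤ (halfOpenBox 4 n ×ˢ ((Finset.univ : Finset (Fin 4)) ×ˢ ((Finset.univ : Finset (Fin 4)) ×ˢ
          (Finset.univ : Finset (Fin 4))))).card := by
        rw [cubesIn]; exact Finset.card_filter_le _ _
    _ = 64 * n ^ 4 := by
        rw [Finset.card_product, Finset.card_product, Finset.card_product, card_halfOpenBox,
          Finset.card_univ, Fintype.card_fin]
        ring

/-- Distinct members of a 1-ensemble have disjoint supports. [folklore] -/
theorem pairwiseDisjoint_of_oneEnsemble {N : Finset (CIdx 4 n →₀ ℤ)} (hens : IsOneEnsemble adjC N) :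
    (N : Set (CIdx 4 n →₀ ℤ)).PairwiseDisjoint Finsupp.support := by
  intro ρ hρ ρ' hρ' hne
  rw [Function.onFun, Finset.disjoint_left]
  intro a ha ha'
  exact (hens ρ hρ ρ' hρ' hne a ha a ha').1 rfl

/-- **A 1-ensemble has at most `#CIdx` members.** [folklore] -/
theorem card_le_of_oneEnsemble {N : Finset (CIdx 4 n →₀ ℤ)} (hens : IsOneEnsemble adjC N)
    (hne : ∀ ρ ∈ N, ρ ≠ 0) : N.card ≤ Fintype.card (CIdx 4 n) := by
  classical
  have h := card_filter_subset_le N Finsupp.support (pairwiseDisjoint_of_oneEnsemble hens)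
    (fun ρ hρ => Finsupp.support_nonempty_iff.2 (hne ρ hρ)) Finset.univ (fun _ => True)
    (fun ρ _ _ => Finset.subset_univ _)
  simpa using h

/-- The cubes with base point in a box inject into `box × Fin 4³`. [folklore] -/
theorem card_filter_base_mem_le (B : Finset (ZSite 4)) [DecidablePred fun c : CIdx 4 n => c.1.1 ∈ B] :
    (Finset.univ.filter fun c : CIdx 4 n => c.1.1 ∈ B).card ≤ 64 * B.card := by
  classical
  calc (Finset.univ.filter fun c : CIdx 4 n => c.1.1 ∈ B).card
      ≤ (B ×ˢ ((Finset.univ : Finset (Fin 4)) ×ˢ ((Finset.univ : Finset (Fin 4)) ×ˢ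
          (Finset.univ : Finset (Fin 4))))).card := by
        refine Finset.card_le_card_of_injOn (fun c => c.1) (fun c hc => ?_) ?_
        · simp only [Finset.coe_filter, Finset.mem_univ, true_and, Set.mem_setOf_eq] at hc
          simp [hc]
        · intro c _ c' _ h
          exact Subtype.ext h
    _ = 64 * B.card := by
        rw [Finset.card_product, Finset.card_product, Finset.card_product, Finset.card_univ, Fintype.card_fin]
        ring

/-- The plaquettes with base point in a box inject into `box × Fin 4²`. [folklore] -/
theorem card_filter_plaq_base_mem_le (B : Finset (ZSite 4)) [DecidablePred fun p : PIdx 4 n => p.1.1 ∈ B] :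
    (Finset.univ.filter fun p : PIdx 4 n => p.1.1 ∈ B).card ≤ 16 * B.card := by
  classical
  calc (Finset.univ.filter fun p : PIdx 4 n => p.1.1 ∈ B).card
      ≤ (B ×ˢ ((Finset.univ : Finset (Fin 4)) ×ˢ (Finset.univ : Finset (Fin 4)))).card := by
        refine Finset.card_le_card_of_injOn (fun p => p.1) (fun p hp => ?_) ?_
        · simp only [Finset.coe_filter, Finset.mem_univ, true_and, Set.mem_setOf_eq] at hp
          simp [hp]
        · intro p _ p' _ h
          exact Subtype.ext h
    _ = 16 * B.card := by
        rw [Finset.card_product, Finset.card_product, Finset.card_univ, Fintype.card_fin]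
        ring

/-- **The hull is small**: `#H_ρ ≤ 16 (2 #supp ρ + 3)⁴` (FS82 (2.85)). [cite: FrohlichSpencerCMP1982, §2.10 (2.85)] -/
theorem card_hull_le {ρ : CIdx 4 n →₀ ℤ} (hconn : IsAdjConnected adjC ρ.support) (hne : ρ.support.Nonempty) :
    ((hull ρ).card : ℝ) ≤ 16 * (2 * ρ.support.card + 3) ^ 4 := by
  classical
  obtain ⟨⟨⟨x₀, dirs₀⟩, hmem₀⟩, hc₀⟩ := hne
  set s := ρ.support.card with hs
  set Bll := Finset.Icc (x₀ - fun _ => ((s + 1 : ℕ) : ℤ)) (x₀ + fun _ => ((s + 1 : ℕ) : ℤ)) with hB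
  have hsub : hull ρ ⊆ Finset.univ.filter fun p : PIdx 4 n => p.1.1 ∈ Bll := by
    rintro ⟨⟨y, ij⟩, hpm⟩ hp
    rw [mem_hull] at hp
    refine Finset.mem_filter.2 ⟨Finset.mem_univ _, mem_Icc_site_of_forall_abs_le fun a => ?_⟩
    have h1 := hp.1 a; have h2 := hp.2 a
    have h3 := lowPt_le hc₀ a; have h4 := le_highPt hc₀ a
    have h5 := width_le_card hconn ⟨_, hc₀⟩ a
    simp only [Pi.sub_apply, Pi.add_apply, Pi.ofNat_apply] at h1 h2 h3 h4
    rw [abs_le]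
    push_cast
    constructor <;> omega
  calc ((hull ρ).card : ℝ) ≤ ((Finset.univ.filter fun p : PIdx 4 n => p.1.1 ∈ Bll).card : ℝ) := by
        exact_mod_cast Finset.card_le_card hsub
    _ ≤ ((16 * Bll.card : ℕ) : ℝ) := by exact_mod_cast card_filter_plaq_base_mem_le Bll
    _ = 16 * (2 * (s : ℝ) + 3) ^ 4 := by
        rw [hB, EnsembleExpansion.card_Icc_site]
        push_cast
        ring

/-- **Few densities of a given size near a plaquette** (FS82 (2.86)–(2.87) counting): the members of
a 1-ensemble of size `s` whose hull contains `p` have their (disjoint, non-empty) supports in the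
ball of radius `s + 1` about `p`, so there are at most `64 (2s+3)⁴` of them. [cite: FrohlichSpencerCMP1982, §2.10 (2.86)–(2.87)] -/
theorem card_filter_mem_hull_le {N : Finset (CIdx 4 n →₀ ℤ)} (hens : IsOneEnsemble adjC N)
    (hne : ∀ ρ ∈ N, ρ ≠ 0) (hconn : ∀ ρ ∈ N, IsAdjConnected adjC ρ.support) (p : PIdx 4 n) (s : ℕ) :
    ((N.filter fun ρ => p ∈ hull ρ).filter fun ρ => ρ.support.card = s).card ≤ 64 * (2 * s + 3) ^ 4 := by
  classical
  obtain ⟨⟨y, ij⟩, hpm⟩ := p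
  set Bll := Finset.Icc (y - fun _ => ((s + 1 : ℕ) : ℤ)) (y + fun _ => ((s + 1 : ℕ) : ℤ)) with hB
  rw [Finset.filter_filter]
  have h := card_filter_subset_le N Finsupp.support (pairwiseDisjoint_of_oneEnsemble hens)
    (fun ρ hρ => Finsupp.support_nonempty_iff.2 (hne ρ hρ))
    (Finset.univ.filter fun c : CIdx 4 n => c.1.1 ∈ Bll)
    (fun ρ => (⟨(y, ij), hpm⟩ : PIdx 4 n) ∈ hull ρ ∧ ρ.support.card = s) ?_
  · refine h.trans ((card_filter_base_mem_le Bll).trans ?_)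
    rw [hB, EnsembleExpansion.card_Icc_site]
    ring_nf
    rfl
  · rintro ρ hρ ⟨hp, hcard⟩ ⟨⟨x, dirs⟩, hcm⟩ hc
    rw [mem_hull] at hp
    refine Finset.mem_filter.2 ⟨Finset.mem_univ _, mem_Icc_site_of_forall_abs_le fun a => ?_⟩
    have h1 := hp.1 a; have h2 := hp.2 a
    have h3 := lowPt_le hc a; have h4 := le_highPt hc a
    have h5 := width_le_card (hconn ρ hρ) ⟨_, hc⟩ a
    simp only [Pi.sub_apply, Pi.add_apply, Pi.ofNat_apply] at h1 h2 h3 h4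
    rw [hcard] at h5
    rw [abs_le]
    push_cast
    constructor <;> omega

/-! ### Elementary exponential bounds -/

/-- `x² e^{-x} ≤ 2`, in the form `x² ≤ 2 eˣ`. [folklore] -/
theorem sq_le_two_mul_exp {x : ℝ} (hx : 0 ≤ x) : x ^ 2 ≤ 2 * Real.exp x := by
  have := Real.quadratic_le_exp_of_nonneg hx
  nlinarith

/-- `x⁴ ≤ 256 eˣ` for `x ≥ 0`. [folklore] -/
theorem pow_four_le_mul_exp {x : ℝ} (hx : 0 ≤ x) : x ^ 4 ≤ 256 * Real.exp x := by
  have h1 : x / 4 ≤ Real.exp (x / 4) := by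
    have := Real.add_one_le_exp (x / 4); linarith
  have h2 : (x / 4) ^ 4 ≤ Real.exp (x / 4) ^ 4 := pow_le_pow_left₀ (by positivity) h1 4
  rw [← Real.exp_nat_mul] at h2
  have h3 : ((4 : ℕ) : ℝ) * (x / 4) = x := by push_cast; ring
  rw [h3] at h2
  nlinarith

/-- `2s + 3 ≤ 3 eˢ` for `s ≥ 0`. [folklore] -/
theorem two_mul_add_three_le {s : ℝ} (hs : 0 ≤ s) : 2 * s + 3 ≤ 3 * Real.exp s := by
  have := Real.add_one_le_exp s; nlinarith

/-- `∑_{s=1}^{K} e^{-s} ≤ 1`. [folklore] -/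
theorem sum_exp_neg_le_one (K : ℕ) : ∑ s ∈ Finset.Icc 1 K, Real.exp (-(s : ℝ)) ≤ 1 := by
  have hr0 : 0 ≤ Real.exp (-1) := (Real.exp_pos _).le
  have hr1 : Real.exp (-1) ≤ 1 / 2 := by
    have h2 : (2 : ℝ) ≤ Real.exp 1 := by have := Real.add_one_le_exp (1 : ℝ); linarith
    rw [Real.exp_neg]
    rw [inv_le_comm₀ (Real.exp_pos _) (by norm_num)]
    simpa using h2
  have hgeom := geom_sum_Ico_le_of_lt_one hr0 (hr1.trans_lt (by norm_num)) (m := 1) (n := K + 1)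
  have hIco : Finset.Icc 1 K = Finset.Ico 1 (K + 1) := by
    ext s; simp
  rw [hIco]
  calc ∑ s ∈ Finset.Ico 1 (K + 1), Real.exp (-(s : ℝ)) = ∑ s ∈ Finset.Ico 1 (K + 1), Real.exp (-1) ^ s := by
        refine Finset.sum_congr rfl fun s _ => ?_
        rw [← Real.exp_nat_mul]; ring_nf
    _ ≤ Real.exp (-1) ^ 1 / (1 - Real.exp (-1)) := hgeom
    _ ≤ 1 := by
        rw [pow_one, div_le_one (by linarith)]
        linarith

/-! ### The phase loss bound -/

/-- The constant `c_J` of the local part. [folklore] -/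
def cJ : ℝ := 229376 * 64 * 6561 * π ^ 2

/-- The constant `C₀` of the large densities. [folklore] -/
def C0 : ℝ := 64 * 7 * 256 * π ^ 2

/-- `0 ≤ c_J`. [folklore] -/
theorem cJ_nonneg : 0 ≤ cJ := by unfold cJ; positivity

/-- `0 ≤ C₀`. [folklore] -/
theorem C0_nonneg : 0 ≤ C0 := by unfold C0; positivity

/-- The closed small densities. [folklore] -/
def CS (ρ : CIdx 4 n →₀ ℤ) : Prop := IsClosedFlux (⇑ρ) ∧ Small ρ

/-- The size profile `g(s)` of the local part. [folklore] -/
def gFun (s : ℕ) : ℝ := 229376 * π ^ 2 * (2 * s + 3) ^ 4 * Real.exp (-(9 * (s : ℝ)))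

/-- The counting profile `c(s)`. [folklore] -/
def cFun (s : ℕ) : ℝ := ((64 * (2 * s + 3) ^ 4 : ℕ) : ℝ)

/-- `0 ≤ g`. [folklore] -/
theorem gFun_nonneg (s : ℕ) : 0 ≤ gFun s := by unfold gFun; positivity

/-- **Summability of the profiles**: `∑_{s ≥ 1} g(s) c(s) ≤ c_J` (exponential decay of the
activities against polynomial counting, FS82 (2.86)–(2.87)). [cite: FrohlichSpencerCMP1982, §2.10 (2.86)–(2.87)] -/
theorem sum_gFun_cFun_le (K : ℕ) : ∑ s ∈ Finset.Icc 1 K, gFun s * cFun s ≤ cJ := by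
  calc ∑ s ∈ Finset.Icc 1 K, gFun s * cFun s ≤ ∑ s ∈ Finset.Icc 1 K, cJ * Real.exp (-(s : ℝ)) := by
        refine Finset.sum_le_sum fun s _ => ?_
        simp only [gFun, cFun, cJ]
        push_cast
        have hs0 : (0 : ℝ) ≤ s := Nat.cast_nonneg _
        have h1 : (2 * (s : ℝ) + 3) ^ 8 ≤ (3 * Real.exp s) ^ 8 :=
          pow_le_pow_left₀ (by positivity) (two_mul_add_three_le hs0) 8
        have h2 : (3 * Real.exp (s : ℝ)) ^ 8 = 6561 * Real.exp (8 * s) := by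
          rw [mul_pow, ← Real.exp_nat_mul]; norm_num
        have h3 : Real.exp (8 * (s : ℝ)) * Real.exp (-(9 * (s : ℝ))) = Real.exp (-(s : ℝ)) := by
          rw [← Real.exp_add]; ring_nf
        calc 229376 * π ^ 2 * (2 * (s : ℝ) + 3) ^ 4 * Real.exp (-(9 * (s : ℝ))) * (64 * (2 * (s : ℝ) + 3) ^ 4)
            = 229376 * 64 * π ^ 2 * ((2 * (s : ℝ) + 3) ^ 8 * Real.exp (-(9 * (s : ℝ)))) := by ring
          _ ≤ 229376 * 64 * π ^ 2 * ((6561 * Real.exp (8 * s)) * Real.exp (-(9 * (s : ℝ)))) := by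
              gcongr
              exact h1.trans_eq h2
          _ = 229376 * 64 * 6561 * π ^ 2 * Real.exp (-(s : ℝ)) := by rw [mul_assoc (6561 : ℝ), h3]; ring
    _ = cJ * ∑ s ∈ Finset.Icc 1 K, Real.exp (-(s : ℝ)) := by rw [Finset.mul_sum]
    _ ≤ cJ * 1 := mul_le_mul_of_nonneg_left (sum_exp_neg_le_one K) cJ_nonneg
    _ = cJ := mul_one _

/-- **The local term** (FS82 (2.84)–(2.86)): `γ_ρ M_ρ² #H_ρ ≤ g(#supp ρ)` for
`γ_ρ ≤ 7 e^{-10 ‖ρ‖₂²}`, `M_ρ = 32π ‖ρ‖₁`. [cite: FrohlichSpencerCMP1982, §2.10 (2.84)–(2.86)] -/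
theorem local_term_le {ρ : CIdx 4 n →₀ ℤ} (hconn : IsAdjConnected adjC ρ.support) (hne : ρ ≠ 0)
    {γρ : ℝ} (_hγ0 : 0 ≤ γρ) (hγ1 : γρ ≤ 7 * Real.exp (-(10 * wt ρ))) :
    γρ * (32 * π * l1 ρ) ^ 2 * ((hull ρ).card : ℝ) ≤ gFun ρ.support.card := by
  have hne' : ρ.support.Nonempty := Finsupp.support_nonempty_iff.2 hne
  set s := ρ.support.card with hs
  have hw : (s : ℝ) ≤ wt ρ := card_le_wt ρ
  have hl1 : l1 ρ ≤ wt ρ := l1_le_wt ρ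
  have hl0 : 0 ≤ l1 ρ := l1_nonneg ρ
  have hH := card_hull_le hconn hne'
  have hw0 : 0 ≤ wt ρ := (Nat.cast_nonneg _).trans hw
  -- `w² e^{-10 w} ≤ 2 e^{-9 s}`
  have hexp : wt ρ ^ 2 * Real.exp (-(10 * wt ρ)) ≤ 2 * Real.exp (-(9 * (s : ℝ))) := by
    have h1 := sq_le_two_mul_exp hw0
    have h2 : Real.exp (wt ρ) * Real.exp (-(10 * wt ρ)) = Real.exp (-(9 * wt ρ)) := by
      rw [← Real.exp_add]; ring_nf
    have h3 : Real.exp (-(9 * wt ρ)) ≤ Real.exp (-(9 * (s : ℝ))) := Real.exp_le_exp.2 (by linarith)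
    calc wt ρ ^ 2 * Real.exp (-(10 * wt ρ)) ≤ 2 * Real.exp (wt ρ) * Real.exp (-(10 * wt ρ)) :=
          mul_le_mul_of_nonneg_right h1 (Real.exp_pos _).le
      _ = 2 * Real.exp (-(9 * wt ρ)) := by rw [mul_assoc, h2]
      _ ≤ 2 * Real.exp (-(9 * (s : ℝ))) := by linarith
  rw [gFun]
  calc γρ * (32 * π * l1 ρ) ^ 2 * ((hull ρ).card : ℝ)
      ≤ (7 * Real.exp (-(10 * wt ρ))) * (32 * π * wt ρ) ^ 2 * (16 * (2 * (s : ℝ) + 3) ^ 4) := by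
        gcongr
    _ = 114688 * π ^ 2 * (2 * (s : ℝ) + 3) ^ 4 * (wt ρ ^ 2 * Real.exp (-(10 * wt ρ))) := by ring
    _ ≤ 114688 * π ^ 2 * (2 * (s : ℝ) + 3) ^ 4 * (2 * Real.exp (-(9 * (s : ℝ)))) := by gcongr
    _ = 229376 * π ^ 2 * (2 * (s : ℝ) + 3) ^ 4 * Real.exp (-(9 * (s : ℝ))) := by ring

/-- **The large or non-closed densities**: each contributes at most `7π² e^{-n}`. [cite: FrohlichSpencerCMP1982, §2.10 (2.86)] -/
theorem rest_term_le (hn : 1 ≤ n) (S : PIdx 4 n → ℤ) {ρ : CIdx 4 n →₀ ℤ}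
    (hconn : IsAdjConnected adjC ρ.support) (hne : ρ ≠ 0) (hncs : ¬CS ρ)
    {γρ : ℝ} (hγ1 : γρ ≤ 7 * Real.exp (-(10 * wt ρ))) (hγz : ¬IsClosedFlux (⇑ρ) → γρ = 0) :
    γρ * theta hn S ρ ^ 2 ≤ 7 * π ^ 2 * Real.exp (-(n : ℝ)) := by
  have hθ : |theta hn S ρ| ≤ π := (theta_spec hn S ρ).2.2 fun h => hncs ⟨h.1, h.2.1⟩
  have hθ2 : theta hn S ρ ^ 2 ≤ π ^ 2 := by
    rw [← sq_abs]; exact pow_le_pow_left₀ (abs_nonneg _) hθ 2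
  by_cases hcl : IsClosedFlux (⇑ρ)
  · have hbig : ¬Small ρ := fun h => hncs ⟨hcl, h⟩
    have hcard := le_card_of_not_small hconn (Finsupp.support_nonempty_iff.2 hne) hbig
    have hw : (n : ℝ) ≤ wt ρ := by
      have h1 : ((n : ℤ) : ℝ) ≤ ((ρ.support.card : ℤ) : ℝ) := by exact_mod_cast hcard
      push_cast at h1
      exact h1.trans (card_le_wt ρ)
    have hexp : Real.exp (-(10 * wt ρ)) ≤ Real.exp (-(n : ℝ)) :=
      Real.exp_le_exp.2 (by have : (0 : ℝ) ≤ n := Nat.cast_nonneg _; linarith)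
    calc γρ * theta hn S ρ ^ 2 ≤ (7 * Real.exp (-(10 * wt ρ))) * π ^ 2 :=
          mul_le_mul hγ1 hθ2 (sq_nonneg _) (by positivity)
      _ ≤ 7 * Real.exp (-(n : ℝ)) * π ^ 2 := by gcongr
      _ = 7 * π ^ 2 * Real.exp (-(n : ℝ)) := by ring
  · rw [hγz hcl, zero_mul]
    positivity

/-- `64 n⁴ · 7π² e^{-n} ≤ C₀`. [folklore] -/
theorem card_mul_rest_le (n : ℕ) : (64 * (n : ℝ) ^ 4) * (7 * π ^ 2 * Real.exp (-(n : ℝ))) ≤ C0 := by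
  have h1 := pow_four_le_mul_exp (Nat.cast_nonneg n : (0 : ℝ) ≤ n)
  have h2 : Real.exp (n : ℝ) * Real.exp (-(n : ℝ)) = 1 := by rw [← Real.exp_add]; simp
  have h3 : (n : ℝ) ^ 4 * Real.exp (-(n : ℝ)) ≤ 256 := by
    calc (n : ℝ) ^ 4 * Real.exp (-(n : ℝ)) ≤ 256 * Real.exp (n : ℝ) * Real.exp (-(n : ℝ)) :=
          mul_le_mul_of_nonneg_right h1 (Real.exp_pos _).le
      _ = 256 := by rw [mul_assoc, h2, mul_one]
  calc (64 * (n : ℝ) ^ 4) * (7 * π ^ 2 * Real.exp (-(n : ℝ)))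
      = 64 * 7 * π ^ 2 * ((n : ℝ) ^ 4 * Real.exp (-(n : ℝ))) := by ring
    _ ≤ 64 * 7 * π ^ 2 * 256 := mul_le_mul_of_nonneg_left h3 (by positivity)
    _ = C0 := by rw [C0]; ring

/-- **The phase loss of a 1-ensemble against the Coulomb field of the loop (FS82 (2.81)–(2.87)).**
For a 1-ensemble `𝒩` (coarse adjacency) of non-zero connected densities on the cubes of `B_n` and
weights `0 ≤ γ_ρ ≤ 7 e^{-10 ∑_c ρ_c²}` vanishing on the non-closed densities,
`∑_ρ γ_ρ θ_ρ² ≤ c_J (ε, ε) + C₀` with the phase representatives `θ_ρ` of `theta` and the exact part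
`ε` of the sheet — uniformly in the box and in the ensemble ("we then derive from (2.82)–(2.86) that
`∑_{ρ∈𝒩} γ(z(β,ρ)) θ_ρ² ≤ d(β)(ε_Λ, ε_Λ)`", FS82 (2.87); the additive constant accounts for the
densities as large as the box, absent in the infinite-volume heuristics). [cite: FrohlichSpencerCMP1982, §2.10 (2.81)–(2.87)] -/
theorem sum_gamma_theta_sq_le (hn : 1 ≤ n) (S : PIdx 4 n → ℤ) (N : Finset (CIdx 4 n →₀ ℤ))
    (hens : IsOneEnsemble adjC N) (hne : ∀ ρ ∈ N, ρ ≠ 0)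
    (hconn : ∀ ρ ∈ N, IsAdjConnected adjC ρ.support) (γ : (CIdx 4 n →₀ ℤ) → ℝ)
    (hγ : ∀ ρ ∈ N, 0 ≤ γ ρ ∧ γ ρ ≤ 7 * Real.exp (-(10 * wt ρ)))
    (hγ0 : ∀ ρ ∈ N, ¬IsClosedFlux (⇑ρ) → γ ρ = 0) :
    ∑ ρ ∈ N, γ ρ * theta hn S ρ ^ 2 ≤ cJ * (epsField S ⬝ᵥ epsField S) + C0 := by
  classical
  rw [← Finset.sum_filter_add_sum_filter_not N CS]
  refine add_le_add ?_ ?_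
  · -- the closed small densities: Cauchy–Schwarz and counting
    set Ncs := N.filter CS with hNcs
    set K := Fintype.card (CIdx 4 n) with hK
    have hNcs_sub : Ncs ⊆ N := Finset.filter_subset _ _
    have hens' : IsOneEnsemble adjC Ncs := fun ρ hρ ρ' hρ' => hens ρ (hNcs_sub hρ) ρ' (hNcs_sub hρ')
    have key := sum_mul_sq_le_of_count Ncs hull (fun ρ => ρ.support.card) γ (fun ρ => 32 * π * l1 ρ)
      (theta hn S) (epsField S) gFun cFun (Finset.Icc 1 K)
      (fun ρ hρ => (hγ ρ (hNcs_sub hρ)).1)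
      (fun ρ hρ => (theta_spec hn S ρ).2.1 ⟨(Finset.mem_filter.1 hρ).2.1, (Finset.mem_filter.1 hρ).2.2,
        hne ρ (hNcs_sub hρ)⟩)
      (fun ρ hρ => local_term_le (hconn ρ (hNcs_sub hρ)) (hne ρ (hNcs_sub hρ)) (hγ ρ (hNcs_sub hρ)).1
        (hγ ρ (hNcs_sub hρ)).2)
      gFun_nonneg
      (fun p s => by
        rw [cFun]
        exact_mod_cast card_filter_mem_hull_le hens' (fun ρ hρ => hne ρ (hNcs_sub hρ))
          (fun ρ hρ => hconn ρ (hNcs_sub hρ)) p s)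
      (fun ρ hρ => Finset.mem_Icc.2 ⟨Finset.card_pos.2 (Finsupp.support_nonempty_iff.2 (hne ρ (hNcs_sub hρ))),
        hK ▸ Finset.card_le_univ _⟩)
    refine key.trans ?_
    have hε : ∑ p ∈ Ncs.biUnion hull, epsField S p ^ 2 ≤ epsField S ⬝ᵥ epsField S := by
      calc ∑ p ∈ Ncs.biUnion hull, epsField S p ^ 2 ≤ ∑ p, epsField S p ^ 2 :=
            Finset.sum_le_sum_of_subset_of_nonneg (Finset.subset_univ _) fun p _ _ => sq_nonneg _
        _ = epsField S ⬝ᵥ epsField S := by simp only [dotProduct, sq]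
    have h0 : 0 ≤ ∑ s ∈ Finset.Icc 1 K, gFun s * cFun s :=
      Finset.sum_nonneg fun s _ => mul_nonneg (gFun_nonneg s) (by rw [cFun]; positivity)
    have hεε : 0 ≤ epsField S ⬝ᵥ epsField S := by
      simp only [dotProduct]; exact Finset.sum_nonneg fun _ _ => mul_self_nonneg _
    calc (∑ s ∈ Finset.Icc 1 K, gFun s * cFun s) * ∑ p ∈ Ncs.biUnion hull, epsField S p ^ 2
        ≤ (∑ s ∈ Finset.Icc 1 K, gFun s * cFun s) * (epsField S ⬝ᵥ epsField S) :=
          mul_le_mul_of_nonneg_left hε h0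
      _ ≤ cJ * (epsField S ⬝ᵥ epsField S) := mul_le_mul_of_nonneg_right (sum_gFun_cFun_le K) hεε
  · -- the other densities
    calc ∑ ρ ∈ N.filter (fun ρ => ¬CS ρ), γ ρ * theta hn S ρ ^ 2
        ≤ ∑ ρ ∈ N.filter (fun ρ => ¬CS ρ), 7 * π ^ 2 * Real.exp (-(n : ℝ)) := by
          refine Finset.sum_le_sum fun ρ hρ => ?_
          obtain ⟨hρN, hncs⟩ := Finset.mem_filter.1 hρ
          exact rest_term_le hn S (hconn ρ hρN) (hne ρ hρN) hncs (hγ ρ hρN).2 (hγ0 ρ hρN)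
      _ = ((N.filter fun ρ => ¬CS ρ).card : ℝ) * (7 * π ^ 2 * Real.exp (-(n : ℝ))) := by
          rw [Finset.sum_const, nsmul_eq_mul]
      _ ≤ (64 * (n : ℝ) ^ 4) * (7 * π ^ 2 * Real.exp (-(n : ℝ))) := by
          refine mul_le_mul_of_nonneg_right ?_ (by positivity)
          have h1 := (Finset.card_filter_le N (fun ρ => ¬CS ρ)).trans
            ((card_le_of_oneEnsemble hens hne).trans card_CIdx_le)
          exact_mod_cast h1
      _ ≤ C0 := card_mul_rest_le n

end VillainAngle

end Literature.MathematicalPhysics.QuantumFieldTheory
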